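import Literature.Barriers.ValiantsHypothesis.CT23LowerBoundsFromSuccinctHittingSets
import HarnessLib

/-!
# An annihilator as the determinant of an evaluation matrix with one symbolic row
# (Chatterjee–Tengse arXiv:2309.07612v2, Lemma 3.2 / Claim 3.4 = v1 Lemma 39 / Claim 41;
# val-lit t18 g7, X-CT23 engine brick E-e, part A: the determinant presentation)

Theorem-only (plus one plumbing `def`) companion of
`CT23LowerBoundsFromSuccinctHittingSets.lean`; NO named facts. Honest framing: the linear-algebra
heart of the source's Lemma 3.2 ("Annihilator as a determinant", held v1 text
`paper:arxiv-2309.07612` p0014.txt:L16–L28, Claim 41 p0015.txt:L16–L30); it discharges nothing by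
itself; `VP ≠ VNP` is NOT proved and nothing here bears on it.

## The printed construction (v1 p0015.txt:L1–L35)

"We now define `M̃`, a `K × K` matrix …: `M̃[i, e^{(j)}] = M'[i, e^{(j)}]` if `i ≤ K−2`,
`(−1)^i · x^{e^{(j)}}` if `i = K−1`. … **Claim 41.** `det(M̃) = det(M' ∖ M'[*, e^{(K)}]) · A(x)`.
*Proof.* Note that, by expanding with respect to the last row,
`det(M̃) = Σ_{j=1}^{K} (−1)^{j−1} · det(M' ∖ M'[*, e^{(j)}]) · (−1)^{K−1} · x^{e^{(j)}}` … using
Cramer's Rule … `= A(x)`. Since `det(M' ∖ M'[*,e^{(K)}])` is a fixed, nonzero scalar, `det(M̃)` is an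
annihilator of `G`. Further, since every monomial in `{x^{e^{(j)}}}` has individual degree at most
`D − 1`, `det(M̃)` also has individual degree at most `D − 1`", where (p0015.txt:L49–L55)
`M'[i, e^{(j)}] = (G(v_{α,i}))^{e^{(j)}}` — the rows of `M'` are EVALUATIONS of the column
polynomials `G^{e^{(j)}}` at points.

## Rendering (generic in the data the source fixes later)

`annMatrix N e` = the `(K+1) × (K+1)` matrix over `F[x_σ]` whose first `K` rows are the constant
rows of a scalar matrix `N ∈ F^{K × (K+1)}` and whose last row is the row of monomials `x^{e j}`
(`e : Fin (K+1) → (σ →₀ ℕ)`; the sign `(−1)^{K−1}` of the source only rescales the determinant and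
is dropped). PROVED: the Laplace expansion `det = Σ_j (−1)^{K+j} det(N ∖ col j) · x^{e j}`
(`det_annMatrix`), hence its coefficients / support / individual degrees (`coeff_det_annMatrix`,
`support_det_annMatrix_subset`, `degreeOf_det_annMatrix_lt`) and **non-vanishing as soon as one
maximal minor of `N` is nonzero** (`det_annMatrix_ne_zero`); and the ANNIHILATION
(`map_det_annMatrix_eq_zero`): if the rows of `N` are evaluations `N i j = P_j(p_i)` of polynomials
`P_j` that satisfy a nontrivial linear relation `Σ_j f_j P_j = 0`, then every algebra map sending
`x^{e j} ↦ P_j` (for the source: `A ↦ A ∘ G`, `P_j = G^{e^{(j)}}`) kills `det(annMatrix N e)` — by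
the kernel vector `(f_j)` and `adj(M)·M = det(M)·1` over the domain `F[z]` (the source's "Cramer's
Rule"). The choice of the column monomials `e^{(j)}` (first dependent prefix) and of the evaluation
points (rank extractor, Claim 40) is NOT made here (parts B–D of brick E-e).

## References

* [ChatterjeeTengse2023] P. Chatterjee, A. Tengse, *Lower Bounds from Succinct Hitting Sets*,
  arXiv:2309.07612v2, Lemma 3.2 and its proof (v1: Lemma 39, Claims 40–41; p0014.txt:L16–L92,
  p0015.txt:L1–L56).
-/

noncomputable section

open MvPolynomial Matrix

namespace Literature.Barriers.ValiantsHypothesis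

universe u v w

variable {F : Type u} [Field F] {σ : Type v} {K : ℕ}

/-! ### The matrix `M̃` and its Laplace expansion along the symbolic row -/

/-- **Lemma 3.2's matrix `M̃`**: `K` constant rows (the scalar matrix `N`, in the source the
evaluations `M'[i, e^{(j)}] = (G(v_{α,i}))^{e^{(j)}}`) and a last row of monomials `x^{e j}`.
[cite: ChatterjeeTengse2023, Lemma 3.2 / proof, matrix `M̃` (v1: Lemma 39; p0015.txt:L3–L9)] -/
def annMatrix (N : Matrix (Fin K) (Fin (K + 1)) F) (e : Fin (K + 1) → (σ →₀ ℕ)) :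
    Matrix (Fin (K + 1)) (Fin (K + 1)) (MvPolynomial σ F) :=
  Matrix.of fun i j => Fin.lastCases (monomial (e j) 1) (fun i' : Fin K => C (N i' j)) i

/-- The constant rows. [cite: ChatterjeeTengse2023, Lemma 3.2 (v1: Lemma 39; p0015.txt:L3–L9)] -/
@[simp] theorem annMatrix_castSucc (N : Matrix (Fin K) (Fin (K + 1)) F) (e : Fin (K + 1) → (σ →₀ ℕ))
    (i : Fin K) (j : Fin (K + 1)) : annMatrix N e (Fin.castSucc i) j = C (N i j) := by
  simp [annMatrix]

/-- The symbolic row. [cite: ChatterjeeTengse2023, Lemma 3.2 (v1: Lemma 39; p0015.txt:L3–L9)] -/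
@[simp] theorem annMatrix_last (N : Matrix (Fin K) (Fin (K + 1)) F) (e : Fin (K + 1) → (σ →₀ ℕ))
    (j : Fin (K + 1)) : annMatrix N e (Fin.last K) j = monomial (e j) 1 := by
  simp [annMatrix]

/-- **Claim 41's expansion along the last row**:
`det M̃ = Σ_j (−1)^{K+j} · det(N ∖ column j) · x^{e j}`.
[cite: ChatterjeeTengse2023, Claim 3.4 (v1: Claim 41; p0015.txt:L18–L22)] -/
theorem det_annMatrix (N : Matrix (Fin K) (Fin (K + 1)) F) (e : Fin (K + 1) → (σ →₀ ℕ)) :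
    (annMatrix N e).det =
      ∑ j : Fin (K + 1), monomial (e j) ((-1) ^ (K + j : ℕ) * (N.submatrix id j.succAbove).det) := by
  rw [Matrix.det_succ_row _ (Fin.last K)]
  refine Finset.sum_congr rfl fun j _ => ?_
  have hsub : (annMatrix N e).submatrix (Fin.last K).succAbove j.succAbove =
      (C : F →+* MvPolynomial σ F).mapMatrix (N.submatrix id j.succAbove) := by
    ext i' j'
    simp [Fin.succAbove_last]
  rw [hsub, ← RingHom.map_det, annMatrix_last, Fin.val_last, mul_assoc,
    mul_comm (monomial (e j) (1 : F)), C_mul_monomial, mul_one,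
    show ((-1 : MvPolynomial σ F) ^ (K + (j : ℕ))) = C ((-1 : F) ^ (K + (j : ℕ))) by simp,
    C_mul_monomial]

/-- The coefficient of `x^{e j₀}` in `det M̃` is `± det(N ∖ column j₀)` (distinct column monomials).
[cite: ChatterjeeTengse2023, Claim 3.4 (v1: Claim 41; p0015.txt:L18–L30)] -/
theorem coeff_det_annMatrix (N : Matrix (Fin K) (Fin (K + 1)) F) {e : Fin (K + 1) → (σ →₀ ℕ)}
    (he : Function.Injective e) (j₀ : Fin (K + 1)) :
    coeff (e j₀) (annMatrix N e).det = (-1) ^ (K + j₀ : ℕ) * (N.submatrix id j₀.succAbove).det := by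
  classical
  rw [det_annMatrix, coeff_sum, Finset.sum_eq_single j₀]
  · rw [coeff_monomial, if_pos rfl]
  · intro j _ hj
    rw [coeff_monomial, if_neg (fun h => hj (he h))]
  · simp

/-- **`det M̃ ≠ 0` as soon as one maximal minor of the evaluation block is nonzero** ("since
`det(M' ∖ M'[*, e^{(K)}])` is a fixed, nonzero scalar").
[cite: ChatterjeeTengse2023, proof of Lemma 3.2 (v1: p0015.txt:L32)] -/
theorem det_annMatrix_ne_zero (N : Matrix (Fin K) (Fin (K + 1)) F) {e : Fin (K + 1) → (σ →₀ ℕ)}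
    (he : Function.Injective e) {j₀ : Fin (K + 1)} (h : (N.submatrix id j₀.succAbove).det ≠ 0) :
    (annMatrix N e).det ≠ 0 := by
  intro h0
  have := coeff_det_annMatrix N he j₀
  rw [h0, coeff_zero] at this
  exact h (by
    have h1 : ((-1 : F) ^ (K + j₀ : ℕ)) ≠ 0 := pow_ne_zero _ (by norm_num)
    exact (mul_eq_zero.1 this.symm).resolve_left h1)

/-- The monomials of `det M̃` are among the column labels.
[cite: ChatterjeeTengse2023, proof of Lemma 3.2 (v1: p0015.txt:L32–L33)] -/
theorem support_det_annMatrix_subset [DecidableEq σ] (N : Matrix (Fin K) (Fin (K + 1)) F)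
    (e : Fin (K + 1) → (σ →₀ ℕ)) :
    (annMatrix N e).det.support ⊆ Finset.univ.image e := by
  rw [det_annMatrix]
  refine (support_sum).trans (Finset.biUnion_subset.2 fun j _ => ?_)
  exact (support_monomial_subset).trans (by simp)

/-- **Individual degree**: if every column monomial has `x_t`-degree `< D`, so does `det M̃`
("`det(M̃)` also has individual degree at most `D − 1`").
[cite: ChatterjeeTengse2023, proof of Lemma 3.2 (v1: p0015.txt:L32–L33)] -/
theorem degreeOf_det_annMatrix_lt [DecidableEq σ] (N : Matrix (Fin K) (Fin (K + 1)) F)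
    {e : Fin (K + 1) → (σ →₀ ℕ)} {D : ℕ} (hD : 0 < D) (he : ∀ j t, e j t < D) (t : σ) :
    (annMatrix N e).det.degreeOf t < D := by
  rw [degreeOf_lt_iff hD]
  intro d hd
  obtain ⟨j, -, rfl⟩ := Finset.mem_image.1 (support_det_annMatrix_subset N e hd)
  exact he j t

/-! ### Annihilation: a dependency among the column polynomials kills `det M̃` -/

section Annihilation

variable {τ : Type w}

/-- **`det M̃` is an annihilator** (the source's Cramer step, as a kernel-vector argument over the
domain `F[z]`): if the constant rows are evaluations `N i j = P_j(p_i)` of polynomials `P_j` with a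
nontrivial relation `Σ_j f_j P_j = 0`, then any `F`-algebra map `φ` with `φ(x^{e j}) = P_j` (for
the source, `φ = (· ∘ G)` and `P_j = G^{e^{(j)}}`) satisfies `φ(det M̃) = 0` — indeed `φ(M̃)` has the
nonzero kernel vector `(f_j)`, and `adj(φM̃) · φM̃ = det(φM̃) · 1`.
[cite: ChatterjeeTengse2023, Lemma 3.2 / Claim 3.4 (v1: Lemma 39, Claim 41; p0014.txt:L35–L40, p0015.txt:L16–L32)] -/
theorem map_det_annMatrix_eq_zero (N : Matrix (Fin K) (Fin (K + 1)) F)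
    (e : Fin (K + 1) → (σ →₀ ℕ)) {P : Fin (K + 1) → MvPolynomial τ F}
    (φ : MvPolynomial σ F →ₐ[F] MvPolynomial τ F) (hφ : ∀ j, φ (monomial (e j) 1) = P j)
    {p : Fin K → τ → F} (hN : ∀ i j, N i j = eval (p i) (P j))
    {f : Fin (K + 1) → F} (hf : ∑ j, f j • P j = 0) {j₀ : Fin (K + 1)} (hf0 : f j₀ ≠ 0) :
    φ (annMatrix N e).det = 0 := by
  rw [show φ (annMatrix N e).det = φ.toRingHom (annMatrix N e).det from rfl, RingHom.map_det]
  set M' : Matrix (Fin (K + 1)) (Fin (K + 1)) (MvPolynomial τ F) :=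
    φ.toRingHom.mapMatrix (annMatrix N e) with hM'
  -- the kernel vector
  set v : Fin (K + 1) → MvPolynomial τ F := fun j => C (f j) with hv
  have hMv : M' *ᵥ v = 0 := by
    funext i
    rw [Pi.zero_apply, Matrix.mulVec]
    change ∑ j, M' i j * C (f j) = 0
    induction i using Fin.lastCases with
    | last =>
      have : ∀ j, M' (Fin.last K) j = P j := fun j => by
        simp [hM', RingHom.mapMatrix_apply, Matrix.map_apply, annMatrix_last, hφ]
      simp_rw [this, mul_comm (P _), ← smul_eq_C_mul]
      exact hf
    | cast i =>
      have : ∀ j, M' (Fin.castSucc i) j = C (N i j) := fun j => by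
        simp [hM', RingHom.mapMatrix_apply, Matrix.map_apply, annMatrix_castSucc]
      simp_rw [this, ← C_mul, ← map_sum, hN]
      have h0 : ∑ j, eval (p i) (P j) * f j = eval (p i) (∑ j, f j • P j) := by
        rw [map_sum]
        exact Finset.sum_congr rfl fun j _ => by rw [smul_eval, mul_comm]
      rw [h0, hf, map_zero, C_0]
  -- `det M' • v = adj M' (M' v) = 0`, read at the coordinate `j₀` where `v j₀ = C (f j₀) ≠ 0`
  have hdet : M'.det • v = 0 := by
    rw [← Matrix.one_mulVec v, ← Matrix.smul_mulVec, ← Matrix.adjugate_mul,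
      ← Matrix.mulVec_mulVec, hMv, Matrix.mulVec_zero]
  have := congrFun hdet j₀
  rw [Pi.smul_apply, Pi.zero_apply, smul_eq_mul, mul_eq_zero] at this
  rcases this with h | h
  · exact h
  · exact absurd (C_eq_zero.1 h) hf0

end Annihilation

/-! ### A symbolic last row in general (used for the choice of the evaluation points) -/

section SymbRow

/-- `K` constant rows and an arbitrary last row of polynomials. [cite: ChatterjeeTengse2023, Lemma 3.2 / matrix `M̃` (v1: Lemma 39; p0015.txt:L3–L9)] -/
def symbRowMatrix (N : Matrix (Fin K) (Fin (K + 1)) F) (r : Fin (K + 1) → MvPolynomial σ F) :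
    Matrix (Fin (K + 1)) (Fin (K + 1)) (MvPolynomial σ F) :=
  Matrix.of fun i j => Fin.lastCases (r j) (fun i' : Fin K => C (N i' j)) i

/-- Laplace expansion along the symbolic row. [cite: ChatterjeeTengse2023, Claim 3.4 (v1: Claim 41; p0015.txt:L18–L22)] -/
theorem det_symbRowMatrix (N : Matrix (Fin K) (Fin (K + 1)) F) (r : Fin (K + 1) → MvPolynomial σ F) :
    (symbRowMatrix N r).det =
      ∑ j : Fin (K + 1), C ((-1) ^ (K + j : ℕ) * (N.submatrix id j.succAbove).det) * r j := by
  rw [Matrix.det_succ_row _ (Fin.last K)]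
  refine Finset.sum_congr rfl fun j _ => ?_
  have hsub : (symbRowMatrix N r).submatrix (Fin.last K).succAbove j.succAbove =
      (C : F →+* MvPolynomial σ F).mapMatrix (N.submatrix id j.succAbove) := by
    ext i' j'
    simp [symbRowMatrix, Fin.succAbove_last]
  have hlast : symbRowMatrix N r (Fin.last K) j = r j := by simp [symbRowMatrix]
  rw [hsub, ← RingHom.map_det, hlast, Fin.val_last, mul_assoc, mul_comm (r j), ← mul_assoc,
    map_mul, map_pow, map_neg, map_one]

/-- Evaluating at a point `q` turns the symbolic row into the scalar row `r(q)`.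
[cite: ChatterjeeTengse2023, Lemma 3.2 (v1: Lemma 39; p0015.txt:L3–L9)] -/
theorem eval_det_symbRowMatrix (N : Matrix (Fin K) (Fin (K + 1)) F)
    (r : Fin (K + 1) → MvPolynomial σ F) (q : σ → F) :
    eval q (symbRowMatrix N r).det =
      (Matrix.of fun i j => Fin.lastCases (eval q (r j)) (fun i' : Fin K => N i' j) i).det := by
  rw [show eval q (symbRowMatrix N r).det = (eval q : MvPolynomial σ F →+* F) (symbRowMatrix N r).det
    from rfl, RingHom.map_det]
  congr 1
  ext i j
  induction i using Fin.lastCases with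
  | last => simp [symbRowMatrix]
  | cast i => simp [symbRowMatrix]

end SymbRow

/-! ### Evaluation points in general position (the rank of `M'` is `K − 1`) -/

section Points

variable {m : ℕ}

/-- **Good evaluation points exist** (over an infinite field): for linearly independent
polynomials `P_0, …, P_{K-1}` there are points `p_0, …, p_{K-1}` with `det [P_j(p_i)] ≠ 0` — by
induction, expanding along a symbolic last row (the determinant is then a NONZERO combination of
the independent `P_j`, so it has a non-root). The source obtains such points of the special
Kronecker form `v_{α,i}` by a rank extractor (Claim 3.3 / v1 Claim 40, [GR08]/[FS12]); here:
general position only. [cite: ChatterjeeTengse2023, Claim 3.3 (v1: Claim 40; p0014.txt:L78–L92)] -/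
theorem exists_points_det_eval_ne_zero [Infinite F] :
    ∀ {K : ℕ} (P : Fin K → MvPolynomial (Fin m) F), LinearIndependent F P →
      ∃ p : Fin K → Fin m → F, (Matrix.of fun i j => eval (p i) (P j)).det ≠ 0 := by
  intro K
  induction K with
  | zero => intro P _; exact ⟨Fin.elim0, by simp [Matrix.det_isEmpty]⟩
  | succ K ih =>
    intro P hP
    obtain ⟨p', hp'⟩ := ih (P ∘ Fin.castSucc) (hP.comp _ (Fin.castSucc_injective K))
    set N' : Matrix (Fin K) (Fin (K + 1)) F := Matrix.of fun i j => eval (p' i) (P j) with hN'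
    -- the determinant with a symbolic last row is a nonzero polynomial
    have hQ : (symbRowMatrix N' P).det ≠ 0 := by
      intro h0
      rw [det_symbRowMatrix] at h0
      simp_rw [← smul_eq_C_mul] at h0
      have hall := (Fintype.linearIndependent_iff.1 hP) _ h0 (Fin.last K)
      have hne : (N'.submatrix id (Fin.last K).succAbove).det ≠ 0 := by
        have : N'.submatrix id (Fin.last K).succAbove =
            Matrix.of fun i j => eval (p' i) ((P ∘ Fin.castSucc) j) := by
          ext i j; simp [hN', Fin.succAbove_last]
        rw [this]; exact hp'
      exact hne ((mul_eq_zero.1 hall).resolve_left (pow_ne_zero _ (by norm_num)))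
    -- hence it has a non-root
    obtain ⟨q, hq⟩ : ∃ q : Fin m → F, eval q (symbRowMatrix N' P).det ≠ 0 := by
      by_contra h
      exact hQ (MvPolynomial.funext fun x => by
        rw [map_zero]; exact not_not.1 (not_exists.1 h x))
    refine ⟨Fin.snoc p' q, ?_⟩
    rw [eval_det_symbRowMatrix] at hq
    convert hq using 2
    ext i j
    induction i using Fin.lastCases with
    | last => simp
    | cast i => simp [hN']

end Points

/-! ### Lemma 3.2, semantic form: a nonzero annihilator of individual degree `< D` IS the
determinant of an evaluation matrix with a symbolic row of monomials -/

section Assembly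

variable {m n : ℕ}

/-- **Lemma 3.2 (v1 Lemma 39) — the determinant presentation, with points in general position.**
For a degree-`d` polynomial map `G : F^m → F^n` and `D` with `(n(D−1)d+1)^m < D^n` there are
distinct column monomials `e_0, …, e_K` of individual degree `< D` and points `p_0, …, p_{K−1}`
such that the determinant of the matrix with rows `((G^{e_j})(p_i))_j` (`i < K`) and last row
`(x^{e_j})_j` is a NONZERO ANNIHILATOR of `G` of individual degree `< D`. (The source chooses the
lexicographically first dependent prefix of columns and Kronecker points `v_{α,i}` from a rank
extractor — which makes the matrix EXPLICIT, Lemma 3.5 / v1 Lemma 42; here the columns are a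
maximal independent subfamily plus one more, and the points are in general position.) `F` of
characteristic `0`.
[cite: ChatterjeeTengse2023, Lemma 3.2 and Claims 3.3–3.4 (v1: Lemma 39, Claims 40–41; p0014.txt:L16–L92, p0015.txt:L1–L35)] -/
theorem exists_annihilator_eq_det_annMatrix [CharZero F] {d D : ℕ}
    (G : Fin n → MvPolynomial (Fin m) F) (hG : ∀ i, (G i).totalDegree ≤ d)
    (hD : (n * (D - 1) * d + 1) ^ m < D ^ n) :
    ∃ (K : ℕ) (e : Fin (K + 1) → (Fin n →₀ ℕ)) (p : Fin K → Fin m → F),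
      Function.Injective e ∧ (∀ j t, e j t < D) ∧
      (annMatrix (Matrix.of fun i j => eval (p i) (∏ t, G t ^ e j t)) e).det ≠ 0 ∧
      (∀ t, (annMatrix (Matrix.of fun i j => eval (p i) (∏ t, G t ^ e j t)) e).det.degreeOf t < D) ∧
      aeval G (annMatrix (Matrix.of fun i j => eval (p i) (∏ t, G t ^ e j t)) e).det = 0 := by
  classical
  haveI : Infinite F := Infinite.of_injective _ (Nat.cast_injective (R := F))
  obtain ⟨A, hA0, hAdeg, hAG⟩ := exists_annihilator_degreeOf_lt G hG hD
  have hD0 : 0 < D := by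
    rcases Nat.eq_zero_or_pos D with h | h
    · exfalso
      subst h
      rcases Nat.eq_zero_or_pos n with hn | hn
      · subst hn; simp at hD
      · exact Nat.not_lt_zero _ (hAdeg ⟨0, hn⟩)
    · exact h
  -- the column polynomials `G^e`, `e` in the support of `A`, are linearly dependent
  set S := A.support with hS
  set Pe : S → MvPolynomial (Fin m) F := fun e => ∏ t, G t ^ (e : Fin n →₀ ℕ) t with hPe
  have hPe_mon : ∀ e : Fin n →₀ ℕ, aeval G (monomial e (1 : F)) = ∏ t, G t ^ e t := fun e => by
    rw [aeval_monomial, map_one, one_mul, Finsupp.prod_pow]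
  have hdep : ¬ LinearIndependent F Pe := by
    rw [Fintype.not_linearIndependent_iff]
    refine ⟨fun e => coeff (e : Fin n →₀ ℕ) A, ?_, ?_⟩
    · have hmon : ∀ e : Fin n →₀ ℕ, aeval G (monomial e (coeff e A)) = coeff e A • ∏ t, G t ^ e t :=
        fun e => by
          rw [← hPe_mon, ← map_smul, smul_monomial, smul_eq_mul, mul_one]
      calc ∑ e : S, coeff (e : Fin n →₀ ℕ) A • Pe e
          = ∑ e ∈ S, coeff e A • ∏ t, G t ^ e t :=
            Finset.sum_coe_sort S (fun e => coeff e A • ∏ t, G t ^ e t)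
        _ = ∑ e ∈ S, aeval G (monomial e (coeff e A)) :=
            Finset.sum_congr rfl fun e _ => (hmon e).symm
        _ = aeval G A := by rw [← map_sum]; exact congrArg _ A.as_sum.symm
        _ = 0 := hAG
    · obtain ⟨e, he⟩ := MvPolynomial.ne_zero_iff.1 hA0
      exact ⟨⟨e, mem_support_iff.2 he⟩, he⟩
  -- a maximal independent subfamily `s` and one more column `e⋆` outside it
  obtain ⟨s, hs, hmax⟩ := exists_maximal_linearIndepOn F Pe
  have hsfin : s.Finite := Set.toFinite s
  obtain ⟨estar, hestar⟩ : ∃ e, e ∉ s := by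
    by_contra h
    have : s = Set.univ := Set.eq_univ_of_forall fun x => not_not.1 (not_exists.1 h x)
    subst this
    exact hdep (linearIndepOn_univ_iff.1 hs)
  obtain ⟨a, ha0, ha⟩ := hmax estar hestar
  -- enumerate `s`
  set K := hsfin.toFinset.card with hK
  let enum : Fin K ≃ hsfin.toFinset := (hsfin.toFinset.equivFin).symm
  let e : Fin (K + 1) → (Fin n →₀ ℕ) :=
    Fin.snoc (fun j => ((enum j : S) : Fin n →₀ ℕ)) (estar : Fin n →₀ ℕ)
  have he_cast : ∀ j : Fin K, e (Fin.castSucc j) = ((enum j : S) : Fin n →₀ ℕ) := fun j => by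
    simp [e]
  have he_last : e (Fin.last K) = (estar : Fin n →₀ ℕ) := by simp [e]
  have hmemS : ∀ j, e j ∈ S := fun j => by
    induction j using Fin.lastCases with
    | last => rw [he_last]; exact estar.2
    | cast j => rw [he_cast]; exact (enum j : S).2
  have henum_mem : ∀ j : Fin K, ((enum j : hsfin.toFinset) : S) ∈ s := fun j => by
    have := (enum j).2
    simpa [Set.Finite.mem_toFinset] using this
  -- injectivity of the column labels
  have hcast_ne_last : ∀ j : Fin K, e (Fin.castSucc j) ≠ e (Fin.last K) := fun j h => by
    rw [he_last, he_cast] at h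
    have : ((enum j : hsfin.toFinset) : S) = estar := Subtype.ext h
    exact hestar (this ▸ henum_mem j)
  have he_inj : Function.Injective e := by
    intro j₁ j₂ h
    induction j₁ using Fin.lastCases with
    | last =>
      induction j₂ using Fin.lastCases with
      | last => rfl
      | cast j₂ => exact absurd h.symm (hcast_ne_last j₂)
    | cast j₁ =>
      induction j₂ using Fin.lastCases with
      | last => exact absurd h (hcast_ne_last j₁)
      | cast j₂ =>
        rw [he_cast, he_cast] at h
        have : enum j₁ = enum j₂ := Subtype.ext (Subtype.ext h)
        rw [Fin.castSucc_inj]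
        exact enum.injective this
  -- the independent prefix and the dependent last column
  set P : Fin (K + 1) → MvPolynomial (Fin m) F := fun j => ∏ t, G t ^ e j t with hP
  have hPind : LinearIndependent F (P ∘ Fin.castSucc) := by
    have h1 : LinearIndependent F (fun x : s => Pe x) := hs
    have h2 : (P ∘ Fin.castSucc) = (fun x : s => Pe x) ∘ (fun j => ⟨_, henum_mem j⟩) := by
      funext j; simp [hP, hPe, he_cast]
    rw [h2]
    refine h1.comp _ fun j₁ j₂ h => ?_
    have h' : ((enum j₁ : hsfin.toFinset) : S) = ((enum j₂ : hsfin.toFinset) : S) :=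
      congrArg (fun x : s => (x : S)) h
    exact enum.injective (Subtype.ext h')
  have hPlast : P (Fin.last K) ∈ Submodule.span F (Set.range (P ∘ Fin.castSucc)) := by
    have hrange : Set.range (P ∘ Fin.castSucc) = Pe '' s := by
      ext y
      simp only [Set.mem_range, Function.comp_apply, Set.mem_image]
      constructor
      · rintro ⟨j, rfl⟩
        exact ⟨_, henum_mem j, by simp [hP, hPe, he_cast]⟩
      · rintro ⟨x, hx, rfl⟩
        refine ⟨enum.symm ⟨x, by simpa [Set.Finite.mem_toFinset] using hx⟩, ?_⟩
        simp [hP, hPe, he_cast]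
    rw [hrange]
    have hsm := Submodule.smul_mem _ a⁻¹ ha
    rw [smul_smul, inv_mul_cancel₀ ha0, one_smul] at hsm
    simpa [hP, hPe, he_last] using hsm
  obtain ⟨c, hc⟩ := (Submodule.mem_span_range_iff_exists_fun F).1 hPlast
  -- good points for the independent prefix
  obtain ⟨p, hp⟩ := exists_points_det_eval_ne_zero (P ∘ Fin.castSucc) hPind
  refine ⟨K, e, p, he_inj,
    fun j t => Nat.lt_of_le_of_lt (monomial_le_degreeOf t (hmemS j)) (hAdeg t), ?_, ?_, ?_⟩
  · -- nonzero: the minor at the last column is the good-points determinant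
    refine det_annMatrix_ne_zero _ he_inj (j₀ := Fin.last K) ?_
    have : (Matrix.of fun i j => eval (p i) (∏ t, G t ^ e j t)).submatrix id (Fin.last K).succAbove =
        Matrix.of fun i j => eval (p i) ((P ∘ Fin.castSucc) j) := by
      ext i j; simp [hP, Fin.succAbove_last]
    rw [this]; exact hp
  · exact degreeOf_det_annMatrix_lt _ hD0 (fun j t =>
      Nat.lt_of_le_of_lt (monomial_le_degreeOf t (hmemS j)) (hAdeg t))
  · -- annihilation with the dependency `Σ_{j<K} c_j P_j − P_K = 0`
    refine map_det_annMatrix_eq_zero _ e (P := P) (aeval G) (fun j => hPe_mon (e j))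
      (p := p) (fun i j => rfl) (f := Fin.snoc c (-1)) ?_ (j₀ := Fin.last K) (by simp)
    rw [Fin.sum_univ_castSucc]
    simp only [Fin.snoc_castSucc, Fin.snoc_last, neg_smul, one_smul]
    rw [show (∑ i : Fin K, c i • P (Fin.castSucc i)) = P (Fin.last K) from hc, add_neg_cancel]

end Assembly

end Literature.Barriers.ValiantsHypothesis
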